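import Summits.Ventures.HSemireg.WedgeHankelRecurrenceGaussChebyshevCharPTable

/-!
# Venture HSemireg — **McDANIEL'S GCD LAW FOR THE LUCAS SEQUENCE `V_n(P, 1)` AS A COROLLARY OF THE DICKSON IDEAL (N466): `gcd(V_m, V_n) = |V_{gcd(m,n)}|` IF `m ∕ gcd`, `n ∕ gcd` ARE BOTH ODD,
# AND `gcd(V_m, V_n) = gcd(2, V_{gcd(m,n)}) ∈ {1, 2}` OTHERWISE** (every integer `P`; `V_0 = 2`, `V_1 = P`, `V_{k+2} = P V_{k+1} − V_k`, so `V_n = C_n(P)`): evaluate the ideal identity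
# `(C_m, C_n) = (C_g)` resp. `(2, C_g)` of `ℤ[X]` at `X = P` and read the gcd off the image ideal of `ℤ` (e.g. `P = 3`: the even-indexed Lucas numbers `L_{2n}`; `P = 4`: `2 T_n(2)`, the
# Pell–Lucas companions)

HONEST FRAMING. Part of the Lean index of the computation cell `pub-hsemireg` (seat p10 gen 48, Sunday typer «UNIFORM-IN-n»).  Integer ∕ ideal arithmetic only; no variety, no cohomology theory,
no sheaf, no Ext group and no semiregularity map is constructed here; nothing here says that HC / HC_CM / HC_AV holds; no Literature fact (unproved `Prop`) is declared or used.  Custodian versions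
as in `WedgeHankelSiegelIdeal` (1/3).
SOURCES (cited).  W. L. McDaniel, *The g.c.d. in Lucas sequences and Lehmer number sequences*, Fibonacci Quart. 29 (1991) 24–29, Main Theorem (case `Q = 1`); P. Ribenboim, *My Numbers, My Friends*
(2000), Ch. 1 (IV.20); P. Hilton, J. Pedersen, L. Somer, *On Lucasian numbers*, Fibonacci Quart. 35 (1997).
PROOF TYPED HERE.  N466 `chebyshevC_span_pair_dichotomy`; Mathlib `Polynomial.evalRingHom`, `Ideal.map_span`, `Set.image_pair ∕ image_singleton`, `span_gcd` (Bézout ∕ PID), `Int.coe_gcd`,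
`Ideal.span_singleton_eq_span_singleton`, `Int.associated_iff_natAbs`, `C_add_two`.
DEDUP DISCLOSURE (`rg -n 'int_gcd_eq_of_span_pair_eq|int_gcd_eq_natAbs_of_span_pair_eq|lucasV_one_eq_chebyshevC_eval|lucasV_one_gcd|gcd_V_V' Summits Literature HarnessLib`, 2026-09-04):
`Literature/NumberTheory/LucasSequences/Divisibility.lean` has `gcd_U_U` (first kind), `gcd_V_Q`, `gcd_U_V_eq_one_or_two` and **`gcd_V_V`** ((IV.28): the ODD ∕ ODD branch below, for general
`P, Q` with `gcd(P,Q) = 1`) — cited; what is added here is the single two-branch statement for `Q = 1` including McDaniel's complementary branch `gcd(V_m, V_n) = gcd(2, V_g) ∈ {1, 2}`, read off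
the polynomial ideal; 0 hits for the 5 names below.

WHAT IS IN THE TREE.  N466; Literature `LucasSequences.Divisibility` (`gcd_U_U`, `gcd_V_V`).
THIS FILE (namespace `Summit.Ventures.HSemireg.Wedge.HankelOuter` continued; CHAINED on N475; 0 definitions):
* §1241 `int_gcd_eq_of_span_pair_eq`, `int_gcd_eq_natAbs_of_span_pair_eq`, `lucasV_one_eq_chebyshevC_eval`, **`lucasV_one_gcd`** (McDaniel, `Q = 1`), `lucasV_one_gcd_dvd_two`.
CAVEATS.  `Q = 1` only (the Dickson parameter `a = 1`); `ℕ`-division conventions as in N458.  Nothing Ext-side.  New names only.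
-/

open Module Polynomial
open scoped Matrix Polynomial

namespace Summit.Ventures.HSemireg.Wedge.HankelOuter

/-! ## §1241. `gcd(V_m, V_n)` for the Lucas sequence `V_n(P, 1) = C_n(P)` -/

/-- In `ℤ`: equal two-generated ideals have equal gcds. [this file, §1241] -/
theorem int_gcd_eq_of_span_pair_eq {x y u v : ℤ} (h : Ideal.span ({x, y} : Set ℤ) = Ideal.span {u, v}) : Int.gcd x y = Int.gcd u v := by
  have h1 : Ideal.span {(GCDMonoid.gcd x y : ℤ)} = Ideal.span {GCDMonoid.gcd u v} := by rw [span_gcd, span_gcd, h]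
  have h2 := Int.associated_iff_natAbs.1 (Ideal.span_singleton_eq_span_singleton.1 h1)
  rwa [← Int.coe_gcd, ← Int.coe_gcd, Int.natAbs_natCast, Int.natAbs_natCast] at h2

/-- In `ℤ`: if `(x, y) = (z)` then `gcd(x, y) = |z|`. [this file, §1241] -/
theorem int_gcd_eq_natAbs_of_span_pair_eq {x y z : ℤ} (h : Ideal.span ({x, y} : Set ℤ) = Ideal.span {z}) : Int.gcd x y = z.natAbs := by
  have h1 : Ideal.span {(GCDMonoid.gcd x y : ℤ)} = Ideal.span {z} := by rw [span_gcd, h]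
  have h2 := Int.associated_iff_natAbs.1 (Ideal.span_singleton_eq_span_singleton.1 h1)
  rwa [← Int.coe_gcd, Int.natAbs_natCast] at h2

/-- `V_n(P, 1) = C_n(P)`: the Lucas sequence of the second kind with `Q = 1` is the Dickson ∕ Vieta–Lucas polynomial evaluated at `P`. [Lidl–Mullen–Turnwald Ch. 2; this file, §1241] -/
theorem lucasV_one_eq_chebyshevC_eval {P : ℤ} {V : ℕ → ℤ} (hV0 : V 0 = 2) (hV1 : V 1 = P) (hV : ∀ n, V (n + 2) = P * V (n + 1) - V n) (n : ℕ) :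
    V n = (Polynomial.Chebyshev.C ℤ (n : ℤ)).eval P := by
  induction n using Nat.strong_induction_on with
  | _ n ih =>
    rcases n with _ | _ | k
    · rw [hV0, Nat.cast_zero, Polynomial.Chebyshev.C_zero, show (2 : ℤ[X]) = Polynomial.C 2 from (Polynomial.C_ofNat 2).symm, eval_C]
    · rw [hV1, Nat.cast_one, Polynomial.Chebyshev.C_one, eval_X]
    · rw [hV k, ih k (by omega), ih (k + 1) (by omega), show (((k + 2 : ℕ)) : ℤ) = (k : ℤ) + 2 by push_cast; ring, Polynomial.Chebyshev.C_add_two,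
        show (((k + 1 : ℕ)) : ℤ) = (k : ℤ) + 1 by push_cast; ring, eval_sub, eval_mul, eval_X]

/-- **McDANIEL'S LAW (`Q = 1`): `gcd(V_m, V_n) = |V_{gcd(m,n)}|` if `m ∕ gcd(m,n)` and `n ∕ gcd(m,n)` are both odd, and `gcd(V_m, V_n) = gcd(2, V_{gcd(m,n)})` otherwise**, for the Lucas sequence
`V_0 = 2`, `V_1 = P`, `V_{k+2} = P V_{k+1} − V_k` over `ℤ` (the first branch is the `Q = 1` case of `Literature…LucasSequences.Divisibility.gcd_V_V`, cited; the second branch is the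
complement). [McDaniel 1991, Main Theorem (Q = 1); Ribenboim (IV.28); this file, §1241] -/
theorem lucasV_one_gcd {P : ℤ} {V : ℕ → ℤ} (hV0 : V 0 = 2) (hV1 : V 1 = P) (hV : ∀ n, V (n + 2) = P * V (n + 1) - V n) (m n : ℕ) :
    Int.gcd (V m) (V n) = if Odd (m / Nat.gcd m n) ∧ Odd (n / Nat.gcd m n) then (V (Nat.gcd m n)).natAbs else Int.gcd 2 (V (Nat.gcd m n)) := by
  have hev : ∀ k : ℕ, Polynomial.evalRingHom P (Polynomial.Chebyshev.C ℤ (k : ℤ)) = V k := fun k => by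
    rw [Polynomial.coe_evalRingHom, lucasV_one_eq_chebyshevC_eval hV0 hV1 hV k]
  obtain ⟨h1, h2⟩ := chebyshevC_span_pair_dichotomy (R := ℤ) m n
  by_cases hP : Odd (m / Nat.gcd m n) ∧ Odd (n / Nat.gcd m n)
  · rw [if_pos hP]
    have h := congrArg (Ideal.map (Polynomial.evalRingHom P)) (h1 hP)
    rw [Ideal.map_span, Ideal.map_span, Set.image_pair, Set.image_singleton, hev, hev, hev] at h
    exact int_gcd_eq_natAbs_of_span_pair_eq h
  · rw [if_neg hP]
    have h := congrArg (Ideal.map (Polynomial.evalRingHom P)) (h2 hP)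
    rw [Ideal.map_span, Ideal.map_span, Set.image_pair, Set.image_pair, hev, hev, hev, Polynomial.coe_evalRingHom,
      show (2 : ℤ[X]) = Polynomial.C 2 from (Polynomial.C_ofNat 2).symm, eval_C] at h
    exact int_gcd_eq_of_span_pair_eq h

/-- Hence in the second case `gcd(V_m, V_n) ∣ 2` (it is `1` or `2`). [McDaniel 1991; this file, §1241] -/
theorem lucasV_one_gcd_dvd_two {P : ℤ} {V : ℕ → ℤ} (hV0 : V 0 = 2) (hV1 : V 1 = P) (hV : ∀ n, V (n + 2) = P * V (n + 1) - V n) {m n : ℕ}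
    (h : ¬ (Odd (m / Nat.gcd m n) ∧ Odd (n / Nat.gcd m n))) : Int.gcd (V m) (V n) ∣ 2 := by
  rw [lucasV_one_gcd hV0 hV1 hV m n, if_neg h, Int.gcd_eq_natAbs]
  exact Nat.gcd_dvd_left 2 _

end Summit.Ventures.HSemireg.Wedge.HankelOuter
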